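import Literature.NumberTheory.LocalFields.UnramifiedQuadraticNormSurjective
import Literature.NumberTheory.Automorphic.UnitaryGroupIntegralPointsReductionInert
import Literature.NumberTheory.Automorphic.UnitaryGroupReductionSurjective
import Literature.NumberTheory.Automorphic.Liu2021.FinAdelicCheckSurjective
import HarnessLib

/-!
# `U_{F_v} = N U_{E_w}` at an inert place: the unit-norm surjectivity of ★ `UnramifiedQuadraticNormSurjective` read on the valuation ring `𝒪[E]`
# of a non-archimedean local field with a valuation-preserving involution, and at the completion of a quadratic extension of number fields

Topic `NumberTheory/LocalFields`; namespace `Literature.NumberTheory.LocalFields.UnramifiedQuadraticNorm` (= ★ `UnramifiedQuadraticNormSurjective` ∕ ★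
`UnramifiedQuadraticNormSemilocal`).  THEOREMS ONLY (no definition, no instance, no notation, no named fact).  Cell `hodgecm-mathlib`, F0∕P3a, brick «D-S3u-N»
(LEAD F0P3a-plan (g8) T7-42; seat F0P3-p02 (g10)) — a DOCKING file: the mathematics ([Serre1979, Ch. V §2 Prop. 3, Cor., Remark 1] «`U_K = N U_L`» for an unramified
quadratic extension with finite residue field) is ★ `exists_mul_map_eq_of_finite_residueField` (local) ∕ ★ `exists_mul_map_eq_of_isReduced_quotient` (semilocal, the
commutant-order form of [Kottwitz1986, §7 proof of Prop. 7.1]) ∕ Mathlib `FiniteField.norm_surjective`; this file only reads it in the currency of ★ D-T1u ∕ D-T1u-H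
(`UnitaryGroupIntegralPointsReduction{,Inert}`, `UnitaryGroupReductionSurjective`): the `ValuativeRel` valuation ring `𝒪[E]` with the binders `σ hσσ hσO σk hσk`.

* §0 (any valued field) `exists_isUnit_map_sub_of_residueHom_ne` — `σ̄ ≠ id ⇒ ∃ a ∈ 𝒪, σ a − a ∈ 𝒪ˣ`.
* §1 (`E` a non-archimedean local field, `[UniformSpace E] [IsUniformAddGroup E]` so that Mathlib's `IsAdicComplete 𝓂[E] 𝒪[E]` fires) **`exists_mul_map_eq_of_isUnit_integer`**
  (`σ` involution preserving `𝒪`, moving an integer by a unit ⇒ every `σ`-fixed unit of `𝒪` is `s · σ s`), **`exists_mul_map_eq_of_residueHom_ne`** (from `σk ≠ id`),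
  **`exists_mul_map_eq_of_frobenius`** (`|𝓀| = q²`, `σk = (·)^q`: ★ `exists_frob_ne`).
* §2 **`exists_mul_galAdicCompletionMap_eq_of_inert`** — `E/F` quadratic number fields, `c ≠ 1`, `c² = 1`, `v` unramified, `c • w = w`: every `σ_w`-fixed unit of `𝒪[E_w]` is a norm
  `s · σ_w s` (★ `residueHom_galAdicCompletionMap_eq_pow`, ★ `natCard_residueField_eq_sq_of_inert`, ★ `galAdicCompletionMap_galAdicCompletionMap_self`).

Consumer: A-p01 (g19) «D-S3u» (the binder `hK1`: one `K_v`-class in the stable class of a residually regular semisimple `γ ∈ U(J)(𝒪_v)` at inert `v` — the rank-one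
hermitian-lattice uniqueness); the commutant-order inputs (`𝒪_w[γ]` complete, `𝒪_w[γ]⧸𝔪_w` finite reduced) stay with that brick.  HC_CM is proved only modulo the printed
citations until rung 0 closes; this file is unconditional.

Dedup: `rg "exists_mul_map_eq_of_isUnit_integer|exists_mul_map_eq_of_frobenius|exists_mul_galAdicCompletionMap_eq" Literature` — none.

## References
* [Serre1979] J.-P. Serre, *Local Fields*, GTM 67 (1979), Ch. V §2 Prop. 3, Corollary and Remark 1.
* [Kottwitz1986] R. E. Kottwitz, *Stable trace formula: elliptic singular terms*, Math. Ann. 275 (1986), §7, proof of Prop. 7.1.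
-/

set_option autoImplicit false

noncomputable section

open ValuativeRel NumberField IsDedekindDomain
open Literature.NumberTheory.LocalFields.UnramifiedQuadraticNorm Literature.NumberTheory.Automorphic

namespace Literature.NumberTheory.LocalFields.UnramifiedQuadraticNorm

/-! ## §0 `σ̄ ≠ id ⇒ σ` moves an integer by a unit (any valued field) -/

section Residue

variable {E : Type*} [Field E] [ValuativeRel E] (σ : E →+* E)

/-- **`σ̄ ≠ id ⇒ σ` moves an integer by a unit**: if the reduction `σk` of `σ` is not the identity of the residue field, some `a ∈ 𝒪` has `σ a − a ∈ 𝒪ˣ`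
(lift a moved residue; the difference has non-zero residue). [cite: Serre1979, Ch. V §2, proof of Prop. 3] -/
theorem exists_isUnit_map_sub_of_residueHom_ne (hσO : ∀ x : 𝒪[E], σ x ∈ 𝒪[E]) (σk : 𝓀[E] →+* 𝓀[E])
    (hσk : ∀ x : 𝒪[E], IsLocalRing.residue 𝒪[E] ⟨σ x, hσO x⟩ = σk (IsLocalRing.residue 𝒪[E] x)) (hne : ∃ y : 𝓀[E], σk y ≠ y) :
    ∃ a : 𝒪[E], IsUnit ((⟨σ a, hσO a⟩ : 𝒪[E]) - a) := by
  obtain ⟨y, hy⟩ := hne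
  obtain ⟨a, rfl⟩ := IsLocalRing.residue_surjective y
  refine ⟨a, ?_⟩
  by_contra h
  apply hy
  rw [← hσk, ← sub_eq_zero, ← map_sub, IsLocalRing.residue_eq_zero_iff]
  exact (IsLocalRing.mem_maximalIdeal _).2 h

end Residue

/-! ## §1 The valuation ring `𝒪[E]` of a non-archimedean local field with a valuation-preserving involution -/

section LocalField

variable {E : Type*} [Field E] [ValuativeRel E] [UniformSpace E] [IsUniformAddGroup E] [IsNonarchimedeanLocalField E]
  (σ : E →+* E)

/-- **`U_K = N U_L` for the valuation ring of a non-archimedean local field**: `σ` an involution of `E` preserving `𝒪 = 𝒪[E]` (`hσO`) and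
MOVING SOME INTEGER BY A UNIT (`hmove`, i.e. `σ̄ ≠ id` on the residue field — the unramified∕inert case); then every `σ`-fixed unit of `𝒪` is a
norm `s · σ s` (★ `exists_mul_map_eq_of_finite_residueField` at `R := 𝒪[E]`, complete for `𝔪` and with finite residue field by Mathlib's
`IsNonarchimedeanLocalField` instances). [cite: Serre1979, Ch. V §2 Prop. 3, Corollary and Remark 1] -/
theorem exists_mul_map_eq_of_isUnit_integer (hσσ : ∀ x, σ (σ x) = x) (hσO : ∀ x : 𝒪[E], σ x ∈ 𝒪[E])
    (hmove : ∃ a : 𝒪[E], IsUnit ((⟨σ a, hσO a⟩ : 𝒪[E]) - a)) (u : 𝒪[E]) (hu : IsUnit u) (hσu : σ u = u) :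
    ∃ s : 𝒪[E], (s : E) * σ s = u := by
  let σO : 𝒪[E] →+* 𝒪[E] := (σ.comp (𝒪[E]).subtype).codRestrict 𝒪[E] fun x => hσO x
  have hσOσ : ∀ a : 𝒪[E], σO (σO a) = a := fun a => Subtype.ext (hσσ a)
  obtain ⟨a, ha⟩ := hmove
  have ha' : IsUnit (σO a - a) := ha
  have hσOu : σO u = u := Subtype.ext hσu
  obtain ⟨s, hs⟩ := exists_mul_map_eq_of_finite_residueField σO hσOσ ha' u hu hσOu
  exact ⟨s, by rw [← hs]; rfl⟩

/-- **`U_K = N U_L` from the residue twist**: with `σk` the reduction of `σ` and `σk ≠ id`, every `σ`-fixed unit of `𝒪[E]` is a norm.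
[cite: Serre1979, Ch. V §2 Prop. 3, Corollary and Remark 1] -/
theorem exists_mul_map_eq_of_residueHom_ne (hσσ : ∀ x, σ (σ x) = x) (hσO : ∀ x : 𝒪[E], σ x ∈ 𝒪[E]) (σk : 𝓀[E] →+* 𝓀[E])
    (hσk : ∀ x : 𝒪[E], IsLocalRing.residue 𝒪[E] ⟨σ x, hσO x⟩ = σk (IsLocalRing.residue 𝒪[E] x)) (hne : ∃ y : 𝓀[E], σk y ≠ y)
    (u : 𝒪[E]) (hu : IsUnit u) (hσu : σ u = u) : ∃ s : 𝒪[E], (s : E) * σ s = u :=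
  exists_mul_map_eq_of_isUnit_integer σ hσσ hσO (exists_isUnit_map_sub_of_residueHom_ne σ hσO σk hσk hne) u hu hσu

/-- **The INERT form** (`σk` the `q`-Frobenius of a residue field of order `q²`, ★ `exists_frob_ne`): every `σ`-fixed unit of `𝒪[E]` is a norm.
[cite: Serre1979, Ch. V §2 Prop. 3, Corollary and Remark 1] -/
theorem exists_mul_map_eq_of_frobenius (hσσ : ∀ x, σ (σ x) = x) (hσO : ∀ x : 𝒪[E], σ x ∈ 𝒪[E]) (σk : 𝓀[E] →+* 𝓀[E])
    (hσk : ∀ x : 𝒪[E], IsLocalRing.residue 𝒪[E] ⟨σ x, hσO x⟩ = σk (IsLocalRing.residue 𝒪[E] x))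
    {q : ℕ} (hk : Nat.card 𝓀[E] = q ^ 2) (hσq : ∀ x : 𝓀[E], σk x = x ^ q)
    (u : 𝒪[E]) (hu : IsUnit u) (hσu : σ u = u) : ∃ s : 𝒪[E], (s : E) * σ s = u := by
  letI : Fintype 𝓀[E] := Fintype.ofFinite _
  have hk' : Fintype.card 𝓀[E] = q ^ 2 := by rw [← Nat.card_eq_fintype_card, hk]
  exact exists_mul_map_eq_of_residueHom_ne σ hσσ hσO σk hσk (Literature.LinearAlgebra.Matrix.exists_frob_ne hk' σk hσq) u hu hσu

end LocalField

/-! ## §2 The completion `E_w` at an INERT place of a quadratic extension of number fields: `U_{F_v} = N_{E_w∕F_v} U_{E_w}` -/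

section InertPlace

variable {F E : Type} [Field F] [NumberField F] [Field E] [NumberField E] [Algebra F E]
  [Algebra.IsQuadraticExtension F E] (c : E ≃ₐ[F] E) (v : HeightOneSpectrum (𝓞 F))

/-- **`U_{F_v} = N U_{E_w}` at an inert place.**  `E/F` quadratic number fields, `c ≠ 1`, `c² = 1`, `v` unramified in `E`, `w ∣ v` with `c • w = w`, `σ_w` the
conjugation of `E_w`: every `σ_w`-fixed unit `u` of `𝒪[E_w]` (i.e. every unit of `𝒪_{F_v}` read in `E_w`) is a norm `s · σ_w s`, `s ∈ 𝒪[E_w]`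
(★ §1 with `σ̄_w = Frob_{q_v}`, ★ `residueHom_galAdicCompletionMap_eq_pow`, `|𝓀[E_w]| = q_v²` ★ `natCard_residueField_eq_sq_of_inert`, `σ_w² = 1` ★
`galAdicCompletionMap_galAdicCompletionMap_self`).  The rank-one hermitian-lattice uniqueness behind Kottwitz's integral conjugacy lemma; the commutant-ORDER
form (`𝒪_w[γ]`, semilocal) is ★ `exists_mul_map_eq_of_isReduced_quotient`. [cite: Serre1979, Ch. V §2 Prop. 3, Corollary and Remark 1]
[cite: Kottwitz1986, §7 proof of Prop. 7.1] -/
theorem exists_mul_galAdicCompletionMap_eq_of_inert (hc : c ≠ 1) (hcc : c * c = 1) (hv : Algebra.IsUnramifiedIn (𝓞 E) v.asIdeal)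
    (w : UnitaryGroup.PlacesOver E v) (hw : c • w.1 = w.1) (u : 𝒪[w.1.adicCompletion E]) (hu : IsUnit u)
    (hσu : galAdicCompletionMap (L := E) c hw u = u) :
    ∃ s : 𝒪[w.1.adicCompletion E], (s : w.1.adicCompletion E) * galAdicCompletionMap (L := E) c hw s = u := by
  obtain ⟨σk, hσk⟩ := exists_residueField_ringHom_galAdicCompletionMap c v w hw
  exact exists_mul_map_eq_of_frobenius (galAdicCompletionMap (L := E) c hw)
    (Literature.NumberTheory.Automorphic.Liu2021.galAdicCompletionMap_galAdicCompletionMap_self F E c hcc hw)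
    (mem_integer_galAdicCompletionMap c v w hw) σk hσk (natCard_residueField_eq_sq_of_inert c v hc hv w hw)
    (residueHom_galAdicCompletionMap_eq_pow c v hc hv w hw σk (mem_integer_galAdicCompletionMap c v w hw) hσk) u hu hσu

end InertPlace

end Literature.NumberTheory.LocalFields.UnramifiedQuadraticNorm
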